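import Summits.KontsevichZagierPeriods.KontsevichZagierPeriods.Theorems.RootDecompRelativeModAbsoluteCircleSplitP08

/-! # `RootDecompRelativeModAbsoluteCircleSplitP09` — part 9/11 of the mechanical ≤400-line split of `csk_min.lean` (sha256 066c56c743abe73e…)
Source: decomp-kz lens-3 g14 CircleSplitK.lean @3d3b9378 (= CircleSplit @d1112051 §0–§25 + §26 kernel split + §27 odd→log; critic CLEARED g6-21 l.1371, g7-2 l.1388) minus the 65 declarations already landed in …CircleLogP1–P11 / …CylLogSplitP46–P49 and minus the 20 superseded g13-glue/tame-class lemmas not on the §26–§27 chain; imports …CylLogSplitP48 + …CircleLogP11; --supports stmt-KontsevichZagierPeriods-30572.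
Split by census-1 g10 `gen/splitlean.py`: scopes re-opened with their `open`/`variable`/`set_option` context; mathematics and declaration order unchanged. -/

noncomputable section
open Set MeasureTheory Filter Topology
open scoped BigOperators
open Literature.NumberTheory.Transcendental Literature.ModelTheory.ExponentialFields
namespace Summit.KontsevichZagierPeriods.RootDecompRelativeModAbsolute.Rung30571.RegularisedLogLayer.CylLog.Leaf
open Set MeasureTheory Filter Topology in
open scoped BigOperators in
open Literature.NumberTheory.Transcendental Literature.ModelTheory.ExponentialFields in
/-- Semialgebraicity of a cylinder monomial `c(x)·θ^M/(1+θκ(x))` (token-identical copy of `RungClosure.lean` v9 §3ag,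
landing as `…CylLogSplitP27`). -/
private theorem sa_cylTerm {b : ℕ} (M : ℕ) {G : Set (Fin b → ℝ)} {B : Set (Fin (b + 1) → ℝ)}
    (hB : IsSemialgebraic ℚ B) (hBG : B ⊆ {z | (Fin.init z : Fin b → ℝ) ∈ G}) {c κ : (Fin b → ℝ) → ℝ}
    (hc : IsSemialgebraicFunOn ℚ G c) (hκ : IsSemialgebraicFunOn ℚ G κ)
    (hden : ∀ z ∈ B, 1 + z (Fin.last b) * κ (Fin.init z) ≠ 0) :
    IsSemialgebraicFunOn ℚ B
      (fun z => c (Fin.init z) * (z (Fin.last b) ^ M / (1 + z (Fin.last b) * κ (Fin.init z)))) := by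
  have hcI : IsSemialgebraicFunOn ℚ B (fun z => c (Fin.init z)) := hc.comp_init.mono hBG hB
  have hκI : IsSemialgebraicFunOn ℚ B (fun z => κ (Fin.init z)) := hκ.comp_init.mono hBG hB
  have hsI : IsSemialgebraicFunOn ℚ B (fun z => z (Fin.last b)) := Literature.NumberTheory.Transcendental.isSemialgebraicFunOn_apply hB (Fin.last b)
  have hdenI : IsSemialgebraicFunOn ℚ B (fun z => 1 + z (Fin.last b) * κ (Fin.init z)) :=
    (IsSemialgebraicFunOn.add_holds (isSemialgebraicFunOn_ratCast hB 1)
      (IsSemialgebraicFunOn.mul_holds hsI hκI)).congr fun _ _ => by simp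
  exact IsSemialgebraicFunOn.mul_holds hcI
    (IsSemialgebraicFunOn.div (isSemialgebraicFunOn_pow' hB hsI M) hdenI hden)

open Set MeasureTheory Filter Topology in
open scoped BigOperators in
open Literature.NumberTheory.Transcendental Literature.ModelTheory.ExponentialFields in
/-- A `θ`-constant integrand `a(x)` is integrable on the closed band `G × [0,1]` when `a ∈ L¹(G)` (token-identical copy
of `RungClosure.lean` v9 §3ag, landing as `…CylLogSplitP27`). -/
private theorem integrableOn_comp_init_band {b : ℕ} {G : Set (Fin b → ℝ)} (hG : IsSemialgebraic ℚ G)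
    {a : (Fin b → ℝ) → ℝ} (ha : IsSemialgebraicFunOn ℚ G a) (hai : IntegrableOn a G) :
    IntegrableOn (fun z : Fin (b + 1) → ℝ => a (Fin.init z)) (KZlog.band G (fun _ => 0) (fun _ => 1)) := by
  have h0sa : IsSemialgebraicFunOn ℚ G (fun _ => (0:ℝ)) :=
    (isSemialgebraicFunOn_ratCast hG 0).congr fun _ _ => by simp
  have h1sa : IsSemialgebraicFunOn ℚ G (fun _ => (1:ℝ)) :=
    (isSemialgebraicFunOn_ratCast hG 1).congr fun _ _ => by simp
  have hband : IsSemialgebraic ℚ (KZlog.band G (fun _ => (0:ℝ)) (fun _ => 1)) :=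
    KZlog.isSemialgebraic_band h0sa h1sa
  have hBm : MeasurableSet (KZlog.band G (fun _ => (0:ℝ)) (fun _ => 1)) := hband.measurableSet_holds
  have hsa : IsSemialgebraicFunOn ℚ (KZlog.band G (fun _ => (0:ℝ)) (fun _ => 1)) (fun z => a (Fin.init z)) :=
    ha.comp_init.mono (fun z hz => hz.1) hband
  refine KZlog.integrableOn_band_of_lintegral_fibre_le hG.measurableSet_holds (a := fun _ => (0:ℝ))
    (b := fun _ => 1) hBm (fun x t => KZlog.snoc_mem_band)
    (KZ.aestronglyMeasurable_of_isSemialgebraicFunOn hsa hBm) (K := a) (fun x _ => ?_) hai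
  simp only [Fin.init_snoc, lintegral_const, Measure.restrict_apply_univ, Real.volume_Icc, sub_zero,
    ENNReal.ofReal_one, mul_one, le_refl]

namespace G13
variable {b : ℕ}

open scoped ContDiff in
/-- **THE KERNEL SPLIT (PROVED): `CylKernelZeroLog ∧ EvenCircleCellClose ⟹ CellCloseCSEven`.** -/
theorem cellCloseCSEven_of_log_and_evenCircle (hL : CylKernelZeroLog) (hEv : EvenCircleCellClose) :
    CellCloseCSEven := by
  classical
  intro E V a₀ q c κ M e σ R f qq S f' m qq' hEo hE ha₀ _ha_sm ha₀i hc hc_sm hκ hκ_sm he heven hκ1 hσ0 hσ1 hσ2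
    hpos hint hL1 hdom hV hpoly _hqq hprod hcoef hqq' hang hπ hcoefA
  have hs : ∀ i, sgnB σ i = true → ∀ x ∈ E, κ i x ≠ 0 := by
    intro i hi x hx
    rcases sgnB_true hi with h0 | h1
    · exact (hσ0 i h0 x hx).ne'
    · exact (hσ1 i h1 x hx).ne
  have hs' : ∀ i, sgnB σ i = false → ∀ x ∈ E, κ i x = 0 := fun i hi x hx => hσ2 i (sgnB_false hi) x hx
  set cylE : Set (Fin (1 + 1) → ℝ) :=
    {z : Fin (1 + 1) → ℝ | (Fin.init z : Fin 1 → ℝ) ∈ E ∧ z (Fin.last 1) ∈ Set.Ioo 0 1} with hcylE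
  have hEm : MeasurableSet E := hE.measurableSet_holds
  have hcyl : IsSemialgebraic ℚ cylE := RTerm.isSemialgebraic_cyl hE
  have hcylm : MeasurableSet cylE := hcyl.measurableSet_holds
  have hcylG : cylE ⊆ {z | (Fin.init z : Fin 1 → ℝ) ∈ E} := fun z hz => hz.1
  have h0sa : IsSemialgebraicFunOn ℚ E (fun _ => (0:ℝ)) :=
    (isSemialgebraicFunOn_ratCast hE 0).congr fun _ _ => by simp
  have h1sa : IsSemialgebraicFunOn ℚ E (fun _ => (1:ℝ)) :=
    (isSemialgebraicFunOn_ratCast hE 1).congr fun _ _ => by simp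
  have hcyl_band : cylE ⊆ KZlog.band E (fun _ => (0:ℝ)) (fun _ => 1) :=
    fun z hz => ⟨hz.1, hz.2.1.le, hz.2.2.le⟩
  have he12 : ∀ i, ¬ e i = 1 → e i = 2 := fun i h => (he i).resolve_left h
  have he21 : ∀ i, ¬ e i = 2 → e i = 1 := fun i h => (he i).resolve_right h
  have hcLog2 : ∀ i, e i = 2 → ∀ x, cLog e (sgnB σ) c κ M i x = 0 := by
    intro i h2 x; have h0 := heven i h2; simp [cLog, h2, h0]
  have hcAtan1 : ∀ i, e i = 1 → ∀ x, cAtan e c κ M i x = 0 := by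
    intro i h1 x; have h12 : ¬ e i = 2 := by omega
    simp [cAtan, h12]
  have hatan1 : ∀ i, e i = 1 → ∀ x, atanArg e κ i x = 0 := by
    intro i h1 x; have h12 : ¬ e i = 2 := by omega
    simp [atanArg, h12]
  have hatan2 : ∀ i, e i = 2 → ∀ x, atanArg e κ i x = Real.sqrt (κ i x) := by
    intro i h2 x; simp [atanArg, h2]
  have hcPoly2 : ∀ i, e i = 2 → ∀ x, cPoly e (sgnB σ) c κ M i x = c i x * sqPoly 0 (M i / 2) (κ i x) := by
    intro i h2 x; have h0 := heven i h2; simp [cPoly, h2, h0]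
  have hcAtan2 : ∀ i, e i = 2 → ∀ x,
      cAtan e c κ M i x = c i x * sqTrans 0 (M i / 2) (κ i x) / Real.sqrt (κ i x) := by
    intro i h2 x; have h0 := heven i h2; simp [cAtan, h2, h0]
  have hsumL : ∀ x ∈ E, ∑ i, cLog e (sgnB σ) c κ M i x * Real.log (1 + κ i x) = 0 := by
    intro x hx
    have hW0 : ∀ i, 0 < 1 + κ i x := fun i => by linarith [hκ1 i x hx]
    have hlogsum : ∀ ρ, ∑ i, (f ρ i : ℝ) * Real.log (1 + κ i x) = 0 := by
      intro ρ
      have h := congrArg Real.log (hprod ρ x hx)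
      rw [Real.log_one, Real.log_prod (fun i _ => zpow_ne_zero _ (hW0 i).ne')] at h
      simpa only [Real.log_zpow] using h
    calc ∑ i, cLog e (sgnB σ) c κ M i x * Real.log (1 + κ i x)
        = ∑ i, (∑ ρ, qq ρ x * (f ρ i : ℝ)) * Real.log (1 + κ i x) :=
          Finset.sum_congr rfl fun i _ => by rw [hcoef i x hx]
      _ = ∑ ρ, qq ρ x * ∑ i, (f ρ i : ℝ) * Real.log (1 + κ i x) := by
          simp only [Finset.sum_mul, Finset.mul_sum, mul_assoc]; exact Finset.sum_comm
      _ = 0 := by simp [hlogsum]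
  have hclosed1 : ∀ i, e i = 1 → ∀ x ∈ E, c i x * ∫ θ in Set.Ioo (0:ℝ) 1, θ ^ M i / (1 + θ * κ i x) =
      cPoly e (sgnB σ) c κ M i x + cLog e (sgnB σ) c κ M i x * Real.log (1 + κ i x) := by
    intro i h1 x hx
    have h := term_eqC e (sgnB σ) c κ M he hs hs' hκ1 hpos i hx
    rw [h1] at h
    simp only [pow_one] at h
    rw [h, hatan1 i h1 x, Real.arctan_zero, mul_zero, add_zero]
  let cL : Fin q → (Fin 1 → ℝ) → ℝ := fun i x => if e i = 1 then c i x else 0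
  let cA : Fin q → (Fin 1 → ℝ) → ℝ := fun i x => if e i = 2 then c i x else 0
  let MA : Fin q → ℕ := fun i => if e i = 2 then M i else 0
  let κA : Fin q → (Fin 1 → ℝ) → ℝ := fun i x => if e i = 2 then κ i x else 1
  let fA : Fin S → Fin q → ℤ := fun s i => if e i = 2 then f' s i else 0
  let a₀L : (Fin 1 → ℝ) → ℝ := fun x => -∑ i, (if e i = 1 then cPoly e (sgnB σ) c κ M i x else 0)
  let a₀A : (Fin 1 → ℝ) → ℝ := fun x => a₀ x - a₀L x
  have hcL_sa : ∀ i, IsSemialgebraicFunOn ℚ E (cL i) := by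
    intro i; by_cases h1 : e i = 1
    · simp only [cL, h1, if_true]; exact hc i
    · simp only [cL, h1, if_false]; exact h0sa
  have hcA_sa : ∀ i, IsSemialgebraicFunOn ℚ E (cA i) := by
    intro i; by_cases h2 : e i = 2
    · simp only [cA, h2, if_true]; exact hc i
    · simp only [cA, h2, if_false]; exact h0sa
  have hcA_sm : ∀ i, ContDiffOn ℝ ∞ (cA i) E := by
    intro i; by_cases h2 : e i = 2
    · simp only [cA, h2, if_true]; exact hc_sm i
    · simp only [cA, h2, if_false]; exact contDiffOn_const
  have hκA_sa : ∀ i, IsSemialgebraicFunOn ℚ E (κA i) := by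
    intro i; by_cases h2 : e i = 2
    · simp only [κA, h2, if_true]; exact hκ i
    · simp only [κA, h2, if_false]; exact h1sa
  have hκA_sm : ∀ i, ContDiffOn ℝ ∞ (κA i) E := by
    intro i; by_cases h2 : e i = 2
    · simp only [κA, h2, if_true]; exact hκ_sm i
    · simp only [κA, h2, if_false]; exact contDiffOn_const
  have hκA_pos : ∀ i, ∀ x ∈ E, 0 < κA i x := by
    intro i x hx; by_cases h2 : e i = 2
    · simp only [κA, h2, if_true]; exact hpos i h2 x hx
    · simp only [κA, h2, if_false]; exact one_pos
  have hMA : ∀ i, MA i % 2 = 0 := by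
    intro i; by_cases h2 : e i = 2
    · simp only [MA, h2, if_true]; exact heven i h2
    · simp only [MA, h2, if_false]
  have hintL : ∀ i, IntegrableOn (fun z : Fin (1 + 1) → ℝ =>
      cL i (Fin.init z) * (z (Fin.last 1) ^ M i / (1 + z (Fin.last 1) * κ i (Fin.init z)))) cylE := by
    intro i; by_cases h1 : e i = 1
    · have h := hint i
      rw [h1] at h
      exact h.congr_fun (fun z _ => by simp only [cL, h1, if_true, pow_one]) hcylm
    · have h0 : (fun z : Fin (1 + 1) → ℝ =>
          cL i (Fin.init z) * (z (Fin.last 1) ^ M i / (1 + z (Fin.last 1) * κ i (Fin.init z)))) = fun _ => 0 := by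
        funext z; simp only [cL, h1, if_false, zero_mul]
      rw [h0]; exact integrableOn_zero
  have hL1L : ∀ i, IntegrableOn (fun x => cL i x * ∫ θ in Set.Ioo (0 : ℝ) 1, θ ^ M i / (1 + θ * κ i x)) E := by
    intro i; by_cases h1 : e i = 1
    · have h := hL1 i
      rw [h1] at h
      exact h.congr_fun (fun x _ => by simp only [cL, h1, if_true, pow_one]) hEm
    · have h0 : (fun x => cL i x * ∫ θ in Set.Ioo (0 : ℝ) 1, θ ^ M i / (1 + θ * κ i x)) = fun _ => 0 := by
        funext x; simp only [cL, h1, if_false, zero_mul]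
      rw [h0]; exact integrableOn_zero
  have hintA : ∀ i, IntegrableOn (fun z : Fin (1 + 1) → ℝ =>
      cA i (Fin.init z) * (z (Fin.last 1) ^ MA i / (1 + z (Fin.last 1) ^ 2 * κA i (Fin.init z)))) cylE := by
    intro i; by_cases h2 : e i = 2
    · have h := hint i
      rw [h2] at h
      exact h.congr_fun (fun z _ => by simp only [cA, MA, κA, h2, if_true]) hcylm
    · have h0 : (fun z : Fin (1 + 1) → ℝ =>
          cA i (Fin.init z) * (z (Fin.last 1) ^ MA i / (1 + z (Fin.last 1) ^ 2 * κA i (Fin.init z)))) =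
          fun _ => 0 := by
        funext z; simp only [cA, h2, if_false, zero_mul]
      rw [h0]; exact integrableOn_zero
  have hL1A : ∀ i, IntegrableOn (fun x => cA i x * ∫ θ in Set.Ioo (0 : ℝ) 1, θ ^ MA i / (1 + θ ^ 2 * κA i x)) E := by
    intro i; by_cases h2 : e i = 2
    · have h := hL1 i
      rw [h2] at h
      exact h.congr_fun (fun x _ => by simp only [cA, MA, κA, h2, if_true]) hEm
    · have h0 : (fun x => cA i x * ∫ θ in Set.Ioo (0 : ℝ) 1, θ ^ MA i / (1 + θ ^ 2 * κA i x)) = fun _ => 0 := by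
        funext x; simp only [cA, h2, if_false, zero_mul]
      rw [h0]; exact integrableOn_zero
  have hkey : ∀ x ∈ E, ∑ i, cL i x * ∫ θ in Set.Ioo (0 : ℝ) 1, θ ^ M i / (1 + θ * κ i x) =
      ∑ i, (if e i = 1 then cPoly e (sgnB σ) c κ M i x else 0) +
        ∑ i, cLog e (sgnB σ) c κ M i x * Real.log (1 + κ i x) := by
    intro x hx
    rw [← Finset.sum_add_distrib]
    refine Finset.sum_congr rfl fun i _ => ?_
    by_cases h1 : e i = 1
    · simp only [cL, h1, if_true]; exact hclosed1 i h1 x hx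
    · simp only [cL, h1, if_false, zero_mul, hcLog2 i (he12 i h1) x, zero_add]
  have ha₀L_eq : ∀ x ∈ E, a₀L x = -∑ i, cL i x * ∫ θ in Set.Ioo (0 : ℝ) 1, θ ^ M i / (1 + θ * κ i x) := by
    intro x hx; simp only [a₀L]; rw [hkey x hx, hsumL x hx, add_zero]
  have ha₀L_sa : IsSemialgebraicFunOn ℚ E a₀L := by
    refine (KZ.isSemialgebraicFunOn_finset_sum Finset.univ hE fun i _ => ?_).neg
    by_cases h1 : e i = 1
    · simp only [h1, if_true]; exact isSemialgebraicFunOn_cPoly hE e (sgnB σ) M hc hκ hs hpos i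
    · simp only [h1, if_false]; exact h0sa
  have ha₀L_neg : IntegrableOn (fun x => -∑ i, cL i x * ∫ θ in Set.Ioo (0 : ℝ) 1, θ ^ M i / (1 + θ * κ i x)) E :=
    (integrable_finsetSum Finset.univ fun i _ => hL1L i).neg
  have ha₀L_int : IntegrableOn a₀L E := ha₀L_neg.congr_fun (fun x hx => (ha₀L_eq x hx).symm) hEm
  have hfibL : ∀ x ∈ E, a₀L x + ∑ i, cL i x * ∫ θ in Set.Ioo (0 : ℝ) 1, θ ^ M i / (1 + θ * κ i x) = 0 := by
    intro x hx; rw [ha₀L_eq x hx]; ring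
  have ha₀A_sa : IsSemialgebraicFunOn ℚ E a₀A := IsSemialgebraicFunOn.sub_holds ha₀ ha₀L_sa
  have ha₀A_int : IntegrableOn a₀A E := ha₀i.sub ha₀L_int
  have hsplit : ∀ i x, cPoly e (sgnB σ) c κ M i x =
      (if e i = 1 then cPoly e (sgnB σ) c κ M i x else 0) + (if e i = 2 then cPoly e (sgnB σ) c κ M i x else 0) := by
    intro i x; rcases he i with h1 | h2
    · simp [h1]
    · simp [h2]
  have hpolyA : ∀ x ∈ E, a₀A x + ∑ i, cA i x * sqPoly 0 (MA i / 2) (κA i x) = 0 := by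
    intro x hx
    have h3 : ∀ i, cA i x * sqPoly 0 (MA i / 2) (κA i x) = if e i = 2 then cPoly e (sgnB σ) c κ M i x else 0 := by
      intro i; by_cases h2 : e i = 2
      · simp only [cA, MA, κA, h2, if_true]; rw [hcPoly2 i h2 x]
      · simp only [cA, MA, κA, h2, if_false, zero_mul]
    simp only [a₀A, a₀L, h3, sub_neg_eq_add]
    rw [add_assoc, ← Finset.sum_add_distrib,
      show ∑ i, ((if e i = 1 then cPoly e (sgnB σ) c κ M i x else 0) +
        (if e i = 2 then cPoly e (sgnB σ) c κ M i x else 0)) = ∑ i, cPoly e (sgnB σ) c κ M i x from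
        Finset.sum_congr rfl fun i _ => (hsplit i x).symm]
    exact hpoly x hx
  have hangA : ∀ s, ∀ x ∈ E, ∑ i, (fA s i : ℝ) * Real.arctan (Real.sqrt (κA i x)) = (m s : ℝ) * Real.pi := by
    intro s x hx
    rw [← hang s x hx]
    refine Finset.sum_congr rfl fun i _ => ?_
    by_cases h2 : e i = 2
    · simp only [fA, κA, h2, if_true, hatan2 i h2 x]
    · simp only [fA, κA, h2, if_false, Int.cast_zero, zero_mul, hatan1 i (he21 i h2) x, Real.arctan_zero, mul_zero]
  have hcoefAA : ∀ i, ∀ x ∈ E,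
      cA i x * sqTrans 0 (MA i / 2) (κA i x) / Real.sqrt (κA i x) = ∑ s, qq' s x * (fA s i : ℝ) := by
    intro i x hx; by_cases h2 : e i = 2
    · simp only [cA, MA, κA, fA, h2, if_true]
      rw [← hcAtan2 i h2 x]; exact hcoefA i x hx
    · simp only [cA, fA, h2, if_false, zero_mul, zero_div, Int.cast_zero, mul_zero, Finset.sum_const_zero]
  have hden_cyl : ∀ i, ∀ z ∈ cylE, 1 + z (Fin.last 1) ^ e i * κ i (Fin.init z) ≠ 0 := fun i z hz =>
    (one_add_pow_mul_pos (e i) hz.2.1.le hz.2.2.le (hκ1 i _ hz.1)).ne'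
  have hden1_cyl : ∀ i, ∀ z ∈ cylE, 1 + z (Fin.last 1) * κ i (Fin.init z) ≠ 0 := fun i z hz => by
    simpa using (one_add_pow_mul_pos 1 hz.2.1.le hz.2.2.le (hκ1 i _ hz.1)).ne'
  have hden2_cyl : ∀ i, ∀ z ∈ cylE, 1 + z (Fin.last 1) ^ 2 * κA i (Fin.init z) ≠ 0 := fun i z hz =>
    (one_add_pow_mul_pos 2 hz.2.1.le hz.2.2.le (by linarith [hκA_pos i _ hz.1])).ne'
  have ha₀cyl : IsSemialgebraicFunOn ℚ cylE (fun z => a₀ (Fin.init z)) := ha₀.comp_init.mono hcylG hcyl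
  have ha₀Lcyl : IsSemialgebraicFunOn ℚ cylE (fun z => a₀L (Fin.init z)) := ha₀L_sa.comp_init.mono hcylG hcyl
  have ha₀Acyl : IsSemialgebraicFunOn ℚ cylE (fun z => a₀A (Fin.init z)) := ha₀A_sa.comp_init.mono hcylG hcyl
  have hTm_cyl : ∀ i, IsSemialgebraicFunOn ℚ cylE (fun z => c i (Fin.init z) *
      (z (Fin.last 1) ^ M i / (1 + z (Fin.last 1) ^ e i * κ i (Fin.init z)))) :=
    fun i => sa_cylTermE (M i) (e i) hcyl hcylG (hc i) (hκ i) (hden_cyl i)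
  have hTmL_cyl : ∀ i, IsSemialgebraicFunOn ℚ cylE (fun z => cL i (Fin.init z) *
      (z (Fin.last 1) ^ M i / (1 + z (Fin.last 1) * κ i (Fin.init z)))) :=
    fun i => sa_cylTerm (M i) hcyl hcylG (hcL_sa i) (hκ i) (hden1_cyl i)
  have hTmA_cyl : ∀ i, IsSemialgebraicFunOn ℚ cylE (fun z => cA i (Fin.init z) *
      (z (Fin.last 1) ^ MA i / (1 + z (Fin.last 1) ^ 2 * κA i (Fin.init z)))) :=
    fun i => sa_cylTermE (MA i) 2 hcyl hcylG (hcA_sa i) (hκA_sa i) (hden2_cyl i)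
  have hA₀int : IntegrableOn (fun z : Fin (1 + 1) → ℝ => a₀ (Fin.init z)) cylE :=
    (integrableOn_comp_init_band hE ha₀ ha₀i).mono_set hcyl_band
  have hA₀Lint : IntegrableOn (fun z : Fin (1 + 1) → ℝ => a₀L (Fin.init z)) cylE :=
    (integrableOn_comp_init_band hE ha₀L_sa ha₀L_int).mono_set hcyl_band
  have hA₀Aint : IntegrableOn (fun z : Fin (1 + 1) → ℝ => a₀A (Fin.init z)) cylE :=
    (integrableOn_comp_init_band hE ha₀A_sa ha₀A_int).mono_set hcyl_band
  let A : KZ.IntegralRep (1 + 1) :=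
    { domain := cylE, integrand := fun z => a₀ (Fin.init z), isSemialgebraic_domain := hcyl,
      isSemialgebraicFunOn_integrand := ha₀cyl, integrableOn := hA₀int }
  let AL : KZ.IntegralRep (1 + 1) :=
    { domain := cylE, integrand := fun z => a₀L (Fin.init z), isSemialgebraic_domain := hcyl,
      isSemialgebraicFunOn_integrand := ha₀Lcyl, integrableOn := hA₀Lint }
  let AA : KZ.IntegralRep (1 + 1) :=
    { domain := cylE, integrand := fun z => a₀A (Fin.init z), isSemialgebraic_domain := hcyl,
      isSemialgebraicFunOn_integrand := ha₀Acyl, integrableOn := hA₀Aint }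
  let Cy : Fin q → KZ.IntegralRep (1 + 1) := fun i =>
    { domain := cylE,
      integrand := fun z => c i (Fin.init z) * (z (Fin.last 1) ^ M i / (1 + z (Fin.last 1) ^ e i * κ i (Fin.init z))),
      isSemialgebraic_domain := hcyl, isSemialgebraicFunOn_integrand := hTm_cyl i, integrableOn := hint i }
  let CyL : Fin q → KZ.IntegralRep (1 + 1) := fun i =>
    { domain := cylE,
      integrand := fun z => cL i (Fin.init z) * (z (Fin.last 1) ^ M i / (1 + z (Fin.last 1) * κ i (Fin.init z))),
      isSemialgebraic_domain := hcyl, isSemialgebraicFunOn_integrand := hTmL_cyl i, integrableOn := hintL i }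
  let CyA : Fin q → KZ.IntegralRep (1 + 1) := fun i =>
    { domain := cylE,
      integrand := fun z => cA i (Fin.init z) * (z (Fin.last 1) ^ MA i / (1 + z (Fin.last 1) ^ 2 * κA i (Fin.init z))),
      isSemialgebraic_domain := hcyl, isSemialgebraicFunOn_integrand := hTmA_cyl i, integrableOn := hintA i }
  let VL : KZ.IntegralRep (1 + 1) :=
    { domain := cylE,
      integrand := fun z => a₀L (Fin.init z) +
        ∑ i, cL i (Fin.init z) * (z (Fin.last 1) ^ M i / (1 + z (Fin.last 1) * κ i (Fin.init z))),
      isSemialgebraic_domain := hcyl,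
      isSemialgebraicFunOn_integrand := IsSemialgebraicFunOn.add_holds ha₀Lcyl
        (KZ.isSemialgebraicFunOn_finset_sum Finset.univ hcyl fun i _ => hTmL_cyl i),
      integrableOn := hA₀Lint.add (integrable_finsetSum _ fun i _ => hintL i) }
  let VA : KZ.IntegralRep (1 + 1) :=
    { domain := cylE,
      integrand := fun z => a₀A (Fin.init z) +
        ∑ i, cA i (Fin.init z) * (z (Fin.last 1) ^ MA i / (1 + z (Fin.last 1) ^ 2 * κA i (Fin.init z))),
      isSemialgebraic_domain := hcyl,
      isSemialgebraicFunOn_integrand := IsSemialgebraicFunOn.add_holds ha₀Acyl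
        (KZ.isSemialgebraicFunOn_finset_sum Finset.univ hcyl fun i _ => hTmA_cyl i),
      integrableOn := hA₀Aint.add (integrable_finsetSum _ fun i _ => hintA i) }
  have hVL : KZ.of VL ∈ KZ.relations :=
    hL E VL a₀L q cL κ M hE ha₀L_sa ha₀L_int hcL_sa hκ hκ1 hintL hL1L rfl (fun _ _ => rfl)
      (ae_of_all _ fun x hx => hfibL x hx)
  have hVA : KZ.of VA ∈ KZ.relations :=
    hEv E VA a₀A q cA κA MA S fA m qq' hEo hE ha₀A_sa ha₀A_int hcA_sa hcA_sm hκA_sa hκA_sm hMA hκA_pos hintA hL1A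
      rfl (fun _ _ => rfl) hpolyA hqq' hangA hπ hcoefAA
  have r1 : KZ.of V - KZ.of A - ∑ i, KZ.of (Cy i) ∈ KZ.relations :=
    KZ.of_sub_of_sub_sum_mem_relations q V A Cy (by rw [hdom]) (fun i => by rw [hdom]) fun z hz => by rw [hV hz]
  have r2 : KZ.of A - KZ.of AL - ∑ _i : Fin 1, KZ.of AA ∈ KZ.relations :=
    KZ.of_sub_of_sub_sum_mem_relations 1 A AL (fun _ => AA) rfl (fun _ => rfl) fun z _ => by
      simp only [Finset.univ_unique, Fin.default_eq_zero, Finset.sum_singleton]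
      show a₀ (Fin.init z) = a₀L (Fin.init z) + (a₀ (Fin.init z) - a₀L (Fin.init z))
      ring
  have r3 : ∀ i, KZ.of (Cy i) - KZ.of (CyL i) - ∑ _j : Fin 1, KZ.of (CyA i) ∈ KZ.relations := by
    intro i
    refine KZ.of_sub_of_sub_sum_mem_relations 1 (Cy i) (CyL i) (fun _ => CyA i) rfl (fun _ => rfl) fun z _ => ?_
    simp only [Finset.univ_unique, Fin.default_eq_zero, Finset.sum_singleton]
    show c i (Fin.init z) * (z (Fin.last 1) ^ M i / (1 + z (Fin.last 1) ^ e i * κ i (Fin.init z))) =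
      cL i (Fin.init z) * (z (Fin.last 1) ^ M i / (1 + z (Fin.last 1) * κ i (Fin.init z))) +
        cA i (Fin.init z) * (z (Fin.last 1) ^ MA i / (1 + z (Fin.last 1) ^ 2 * κA i (Fin.init z)))
    by_cases h1 : e i = 1
    · simp [cL, cA, h1]
    · have h2 : e i = 2 := he12 i h1
      simp [cL, cA, MA, κA, h2]
  have rL : KZ.of VL - KZ.of AL - ∑ i, KZ.of (CyL i) ∈ KZ.relations :=
    KZ.of_sub_of_sub_sum_mem_relations q VL AL CyL rfl (fun _ => rfl) fun _ _ => rfl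
  have rA : KZ.of VA - KZ.of AA - ∑ i, KZ.of (CyA i) ∈ KZ.relations :=
    KZ.of_sub_of_sub_sum_mem_relations q VA AA CyA rfl (fun _ => rfl) fun _ _ => rfl
  have r3' : ∑ i, KZ.of (Cy i) - ∑ i, KZ.of (CyL i) - ∑ i, KZ.of (CyA i) ∈ KZ.relations := by
    have h := sum_mem fun i (_ : i ∈ (Finset.univ : Finset (Fin q))) => r3 i
    simpa only [Finset.univ_unique, Fin.default_eq_zero, Finset.sum_singleton, Finset.sum_sub_distrib] using h
  have r2' : KZ.of A - KZ.of AL - KZ.of AA ∈ KZ.relations := by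
    simpa only [Finset.univ_unique, Fin.default_eq_zero, Finset.sum_singleton] using r2
  have eV : KZ.of V = (KZ.of V - KZ.of A - ∑ i, KZ.of (Cy i)) + (KZ.of A - KZ.of AL - KZ.of AA) +
      (∑ i, KZ.of (Cy i) - ∑ i, KZ.of (CyL i) - ∑ i, KZ.of (CyA i)) +
      (KZ.of VL - (KZ.of VL - KZ.of AL - ∑ i, KZ.of (CyL i))) +
      (KZ.of VA - (KZ.of VA - KZ.of AA - ∑ i, KZ.of (CyA i))) := by abel
  rw [eV]
  exact add_mem (add_mem (add_mem (add_mem r1 r2') r3') (sub_mem hVL rL)) (sub_mem hVA rA)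

/-! ## §27 (g14) ODD CIRCLE ORDERS ARE LOG KIND (`θ' = θ²`) and THE NEW NODE
`CylKernelZeroCirclePos ⟸ CylKernelZeroLog [tree] ∧ EvenCircleCellClose`.
The substitution engine `of_sub_of_mem_relations_of_subst` / `integrableOn_image_substMap_iff` below is the token-identical
copy of HOME g14 `AngleFold.lean` §B1 (farm rc 0), namespaced `KernelSplit`. -/

namespace KernelSplit

section Subst

variable {m : ℕ}

/-- Auxiliary step `eq_snoc_init_zero_add''` (§27): eq snoc init zero add''. [bookkeeping] -/
private theorem eq_snoc_init_zero_add'' (m : ℕ) (w : Fin (m + 1) → ℝ) :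
    w = Fin.snoc (Fin.init w) (0 : ℝ) + w (Fin.last m) • (Pi.single (Fin.last m) (1 : ℝ) : Fin (m + 1) → ℝ) := by
  ext i
  refine Fin.lastCases ?_ (fun j => ?_) i
  · simp
  · simp [(Fin.castSucc_lt_last j).ne, Fin.init]

/-- The substitution map `z ↦ (init z, ψ z)`. -/
def substMap (ψ : (Fin (m + 1) → ℝ) → ℝ) : (Fin (m + 1) → ℝ) → (Fin (m + 1) → ℝ) :=
  fun z => Fin.snoc (Fin.init z) (ψ z)

/-- Auxiliary step `substMap_apply` (§27): subst Map apply. [bookkeeping] -/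
theorem substMap_apply (ψ : (Fin (m + 1) → ℝ) → ℝ) (z : Fin (m + 1) → ℝ) :
    substMap ψ z = Fin.snoc (Fin.init z) (ψ z) := rfl

/-- Auxiliary step `init_substMap` (§27): init subst Map. [bookkeeping] -/
@[simp] theorem init_substMap (ψ : (Fin (m + 1) → ℝ) → ℝ) (z : Fin (m + 1) → ℝ) :
    Fin.init (substMap ψ z) = Fin.init z := by
  simp [substMap]

/-- Auxiliary step `substMap_last` (§27): subst Map last. [bookkeeping] -/
@[simp] theorem substMap_last (ψ : (Fin (m + 1) → ℝ) → ℝ) (z : Fin (m + 1) → ℝ) :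
    substMap ψ z (Fin.last m) = ψ z := by
  simp [substMap]

end Subst
end KernelSplit
end G13
end Summit.KontsevichZagierPeriods.RootDecompRelativeModAbsolute.Rung30571.RegularisedLogLayer.CylLog.Leaf
end
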